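import Mathlib
import Literature.Analysis.PDE.Wave1DFarComparisonLimits
import Literature.Analysis.PDE.Wave1DSpatialReflection
import Literature.Analysis.PDE.FarKernelSpanLemmas
import HarnessLib

/-!
# Lemmas for the far-side channel core: absorption of an infimum, energies of differences

Analysis/PDE support file (everything proved) for the far-side channel estimate of
`FixedModeChannels` (route PhotonSphereChannels, stmt-FinalStateConjecture-10048):
`iInf_absorb` (if `E ≥ 0` on a nonempty index type and for all `v₀` and `δ > 0` some `v` has
`E v ≤ a + θ E v₀ + δ` with `θ ≤ ½`, then `⨅ E ≤ 2a`), `wave1D_sub_facts` (the difference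
`ψ − k` of a global solution and a kernel combination: `C²`, residual `−resid k`, finite data
energy, exterior-energy limits at most twice those of `ψ`). Folklore.
-/

noncomputable section

namespace Literature.Analysis.PDE

open MeasureTheory Set Filter Topology Real

/-- **Absorbing an infimum.** [folklore] -/
theorem iInf_absorb {V : Type*} [Nonempty V] {E : V → ℝ} {a θ : ℝ} (hE : ∀ v, 0 ≤ E v)
    (hθ0 : 0 ≤ θ) (hθ : θ ≤ 1 / 2)
    (h : ∀ v₀, ∀ δ > 0, ∃ v, E v ≤ a + θ * E v₀ + δ) : (⨅ v, E v) ≤ 2 * a := by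
  have hbdd : BddBelow (Set.range E) := ⟨0, by rintro _ ⟨v, rfl⟩; exact hE v⟩
  set X := ⨅ v, E v with hX
  have hX0 : 0 ≤ X := le_ciInf hE
  -- `X ≤ a + θ E v₀` for every `v₀`
  have hkey : ∀ v₀, X ≤ a + θ * E v₀ := by
    intro v₀
    refine le_of_forall_pos_le_add fun δ hδ => ?_
    obtain ⟨v, hv⟩ := h v₀ δ hδ
    exact (ciInf_le hbdd v).trans hv
  -- hence `X ≤ a + θ X`
  have hX : X ≤ a + θ * X := by
    have : θ * X = ⨅ v, θ * E v := (Real.mul_iInf_of_nonneg hθ0 _).symm ▸ rfl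
    have h2 : X - a ≤ θ * X := by
      rw [Real.mul_iInf_of_nonneg hθ0]
      exact le_ciInf fun v => by linarith [hkey v]
    linarith
  nlinarith

variable {P : ℝ → ℝ} {ψ k : ℝ → ℝ → ℝ}

/-- **The difference of a global solution and a kernel combination.** [folklore] -/
theorem wave1D_sub_facts (hPc : Continuous P) (hP0 : ∀ z, 0 ≤ P z)
    (hψ : ContDiff ℝ 2 (Function.uncurry ψ))
    (hsol : ∀ t x, iteratedDeriv 2 (fun τ => ψ τ x) t - iteratedDeriv 2 (ψ t) x + P x * ψ t x = 0)
    (hfinψ : ∫⁻ x in Ioi 1, ENNReal.ofReal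
      (deriv (fun τ => ψ τ x) 0 ^ 2 + deriv (ψ 0) x ^ 2 + P x * ψ 0 x ^ 2) < ⊤)
    (hk : ContDiff ℝ 2 (Function.uncurry k))
    (hkres : Continuous fun p : ℝ × ℝ => iteratedDeriv 2 (fun τ => k τ p.2) p.1
      - iteratedDeriv 2 (k p.1) p.2 + P p.2 * k p.1 p.2)
    (hkeq : ∀ t z, (1 : ℝ) ≤ z →
      iteratedDeriv 2 (fun τ => k τ z) t - iteratedDeriv 2 (k t) z + P z * k t z = 0)
    (hkfin : ∫⁻ z in Ioi 1, ENNReal.ofReal (deriv (fun τ => k τ z) 0 ^ 2 + deriv (k 0) z ^ 2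
      + P z * k 0 z ^ 2) < ⊤)
    (hkEt : ∀ t, IntegrableOn (fun z => deriv (fun τ => k τ z) t ^ 2 + deriv (k t) z ^ 2
      + P z * k t z ^ 2) (Ioi (1 + |t|)))
    (hktop : Tendsto (fun t => ∫ z in Ioi (1 + |t|),
      (deriv (fun τ => k τ z) t ^ 2 + deriv (k t) z ^ 2 + P z * k t z ^ 2)) atTop (𝓝 0))
    (hkbot : Tendsto (fun t => ∫ z in Ioi (1 + |t|),
      (deriv (fun τ => k τ z) t ^ 2 + deriv (k t) z ^ 2 + P z * k t z ^ 2)) atBot (𝓝 0))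
    {Lψp Lψm : ℝ}
    (hψp : Tendsto (fun t => ∫ z in Ioi (1 + |t|),
      (deriv (fun τ => ψ τ z) t ^ 2 + deriv (ψ t) z ^ 2 + P z * ψ t z ^ 2)) atTop (𝓝 Lψp))
    (hψm : Tendsto (fun t => ∫ z in Ioi (1 + |t|),
      (deriv (fun τ => ψ τ z) t ^ 2 + deriv (ψ t) z ^ 2 + P z * ψ t z ^ 2)) atBot (𝓝 Lψm)) :
    let φ : ℝ → ℝ → ℝ := fun t z => ψ t z - k t z
    let F : ℝ → ℝ → ℝ := fun t z => -(iteratedDeriv 2 (fun τ => k τ z) t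
      - iteratedDeriv 2 (k t) z + P z * k t z)
    ContDiff ℝ 2 (Function.uncurry φ) ∧ Continuous (Function.uncurry F) ∧
    (∀ t z, iteratedDeriv 2 (fun τ => φ τ z) t - iteratedDeriv 2 (φ t) z + P z * φ t z = F t z) ∧
    (∀ τ z, 1 ≤ z → F τ z = 0) ∧
    (∫⁻ z in Ioi 1, ENNReal.ofReal
      (deriv (fun τ => φ τ z) 0 ^ 2 + deriv (φ 0) z ^ 2 + P z * φ 0 z ^ 2)) < ⊤ ∧
    ∃ Lp Lm : ℝ, Lp ≤ 2 * Lψp ∧ Lm ≤ 2 * Lψm ∧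
      Tendsto (fun t => ∫ z in Ioi (1 + |t|),
        (deriv (fun τ => φ τ z) t ^ 2 + deriv (φ t) z ^ 2 + P z * φ t z ^ 2)) atTop (𝓝 Lp) ∧
      Tendsto (fun t => ∫ z in Ioi (1 + |t|),
        (deriv (fun τ => φ τ z) t ^ 2 + deriv (φ t) z ^ 2 + P z * φ t z ^ 2)) atBot (𝓝 Lm) := by
  intro φ F
  have hφC : ContDiff ℝ 2 (Function.uncurry φ) := hψ.sub hk
  have hFc : Continuous (Function.uncurry F) := by
    have : Function.uncurry F = fun p : ℝ × ℝ => -(iteratedDeriv 2 (fun τ => k τ p.2) p.1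
        - iteratedDeriv 2 (k p.1) p.2 + P p.2 * k p.1 p.2) := by
      funext p; rfl
    rw [this]; exact hkres.neg
  have hres : ∀ t z, iteratedDeriv 2 (fun τ => φ τ z) t - iteratedDeriv 2 (φ t) z + P z * φ t z
      = F t z := by
    intro t z
    have e1 : iteratedDeriv 2 (fun τ => φ τ z) t
        = iteratedDeriv 2 (fun τ => ψ τ z) t - iteratedDeriv 2 (fun τ => k τ z) t :=
      iteratedDeriv_fun_sub ((contDiff_two_slices'' hψ t z).1.contDiffAt)
        ((contDiff_two_slices'' hk t z).1.contDiffAt)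
    have e2 : iteratedDeriv 2 (φ t) z = iteratedDeriv 2 (ψ t) z - iteratedDeriv 2 (k t) z := by
      show iteratedDeriv 2 (fun y => ψ t y - k t y) z = _
      exact iteratedDeriv_fun_sub ((contDiff_two_slices'' hψ t z).2.contDiffAt)
        ((contDiff_two_slices'' hk t z).2.contDiffAt)
    rw [e1, e2]
    have h1 := hsol t z
    show _ = -(iteratedDeriv 2 (fun τ => k τ z) t - iteratedDeriv 2 (k t) z + P z * k t z)
    simp only [φ]; linarith
  have hF0 : ∀ τ z, 1 ≤ z → F τ z = 0 := fun τ z hz => by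
    show -(iteratedDeriv 2 (fun s => k s z) τ - iteratedDeriv 2 (k τ) z + P z * k τ z) = 0
    rw [hkeq τ z hz, neg_zero]
  -- splitting of the lower Lebesgue energies
  have hsplit : ∀ t (s : Set ℝ), ∫⁻ z in s, ENNReal.ofReal
      (deriv (fun τ => φ τ z) t ^ 2 + deriv (φ t) z ^ 2 + P z * φ t z ^ 2)
      ≤ (2 * ∫⁻ z in s, ENNReal.ofReal
          (deriv (fun τ => ψ τ z) t ^ 2 + deriv (ψ t) z ^ 2 + P z * ψ t z ^ 2))
        + 2 * ∫⁻ z in s, ENNReal.ofReal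
          (deriv (fun τ => k τ z) t ^ 2 + deriv (k t) z ^ 2 + P z * k t z ^ 2) := fun t s =>
    wave1D_energy_lintegral_sub_le hPc hP0 hψ hk s t
  have hfin : (∫⁻ z in Ioi 1, ENNReal.ofReal
      (deriv (fun τ => φ τ z) 0 ^ 2 + deriv (φ 0) z ^ 2 + P z * φ 0 z ^ 2)) < ⊤ := by
    refine (hsplit 0 (Ioi 1)).trans_lt ?_
    have h1 : (2 : ENNReal) * ∫⁻ z in Ioi 1, ENNReal.ofReal
        (deriv (fun τ => ψ τ z) 0 ^ 2 + deriv (ψ 0) z ^ 2 + P z * ψ 0 z ^ 2) < ⊤ :=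
      ENNReal.mul_lt_top (by simp) hfinψ
    have h2 : (2 : ENNReal) * ∫⁻ z in Ioi 1, ENNReal.ofReal
        (deriv (fun τ => k τ z) 0 ^ 2 + deriv (k 0) z ^ 2 + P z * k 0 z ^ 2) < ⊤ :=
      ENNReal.mul_lt_top (by simp) hkfin
    exact ENNReal.add_lt_top.2 ⟨h1, h2⟩
  -- limits
  have hψF : ∀ t x, iteratedDeriv 2 (fun τ => ψ τ x) t - iteratedDeriv 2 (ψ t) x + P x * ψ t x
      = (fun _ _ => (0:ℝ)) t x := hsol
  obtain ⟨Lp, Lm, -, -, -, -, hTp, hTm⟩ := wave1D_exists_farEnergy_limits hPc hP0 hFc hφC hres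
    (c := 1) hF0 hfin
  have hiφ := fun t => (wave1D_farEnergy_integrableOn hPc hP0 hFc hφC hres (c := 1) hF0 hfin t).2
  have hiψ := fun t => (wave1D_farEnergy_integrableOn hPc hP0 continuous_const hψ hψF (c := 1)
    (fun _ _ _ => rfl) hfinψ t).2
  have hik : ∀ t, ENNReal.ofReal (∫ z in Ioi (1 + |t|), (deriv (fun τ => k τ z) t ^ 2
      + deriv (k t) z ^ 2 + P z * k t z ^ 2)) = ∫⁻ z in Ioi (1 + |t|), ENNReal.ofReal
        (deriv (fun τ => k τ z) t ^ 2 + deriv (k t) z ^ 2 + P z * k t z ^ 2) := fun t =>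
    ofReal_integral_eq_lintegral_ofReal (hkEt t) (ae_of_all _ fun z =>
      wave1D_energyDensity_nonneg hP0 t z)
  have hpt : ∀ t, (∫ z in Ioi (1 + |t|), (deriv (fun τ => φ τ z) t ^ 2 + deriv (φ t) z ^ 2
      + P z * φ t z ^ 2)) ≤ 2 * (∫ z in Ioi (1 + |t|), (deriv (fun τ => ψ τ z) t ^ 2
        + deriv (ψ t) z ^ 2 + P z * ψ t z ^ 2))
        + 2 * ∫ z in Ioi (1 + |t|), (deriv (fun τ => k τ z) t ^ 2 + deriv (k t) z ^ 2
          + P z * k t z ^ 2) := by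
    intro t
    have h := hsplit t (Ioi (1 + |t|))
    rw [← hiφ t, ← hiψ t, ← hik t] at h
    have n1 : (0:ℝ) ≤ 2 * (∫ z in Ioi (1 + |t|), (deriv (fun τ => ψ τ z) t ^ 2
        + deriv (ψ t) z ^ 2 + P z * ψ t z ^ 2)) :=
      mul_nonneg (by norm_num) (setIntegral_nonneg measurableSet_Ioi fun z _ =>
        wave1D_energyDensity_nonneg hP0 t z)
    have n2 : (0:ℝ) ≤ 2 * ∫ z in Ioi (1 + |t|), (deriv (fun τ => k τ z) t ^ 2 + deriv (k t) z ^ 2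
        + P z * k t z ^ 2) :=
      mul_nonneg (by norm_num) (setIntegral_nonneg measurableSet_Ioi fun z _ =>
        wave1D_energyDensity_nonneg hP0 t z)
    have e2 : (2 : ENNReal) = ENNReal.ofReal 2 := by simp
    rw [e2, ← ENNReal.ofReal_mul (by norm_num), ← ENNReal.ofReal_mul (by norm_num),
      ← ENNReal.ofReal_add n1 n2] at h
    exact (ENNReal.ofReal_le_ofReal_iff (by linarith)).1 h
  refine ⟨hφC, hFc, hres, hF0, hfin, Lp, Lm, ?_, ?_, hTp, hTm⟩
  · have h := le_of_tendsto_of_tendsto' hTp ((hψp.const_mul 2).add (hktop.const_mul 2)) hpt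
    simpa using h
  · have h := le_of_tendsto_of_tendsto' hTm ((hψm.const_mul 2).add (hkbot.const_mul 2)) hpt
    simpa using h

end Literature.Analysis.PDE
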